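import Mathlib
import Summits.Ventures.PercRepro2.Defs
import Summits.Ventures.PercRepro2.Independence
import Summits.Ventures.PercRepro2.Harris
import Summits.Ventures.PercRepro2.Graph
import Summits.Ventures.PercRepro2.YBridge
import Summits.Ventures.PercRepro2.RootLeafUPocketGraph

/-!
# The root-only pocket at `b`, part 2: stability and the pocket shares (blind cell PercRepro2, p4 g16;
S3 (G4-u) item (ac); no definitions)

`P ∋ b` a root-only pocket for the roots `u, a₂` (RootLeafUPocketGraph; `off`/`inn` the outside and
pocket parts, characterised by `hoff`/`hinn`).  An event `Z` is **`P`-stable** when, whenever the pocket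
part of `ω` does not join `u` to `a₂`, `ω ∈ Z ⟺ off ω ∈ Z`: connections among vertices outside `P`
(`stable_connEvent`), hence `PD`, `T`, `T′` and their intersections with `{o ∈ K}`, `{o ∈ L}` for
`o, c ∉ P`.

The pocket events `Qinn = {the pocket part does not join u, a₂}`, `Kinn = Qinn ∩ {the pocket part joins
a₂, b}`, `Linn = Qinn ∩ {the pocket part joins u, b}` are determined by the pocket edges, the off-copy
`Z₀ = {ω | off ω ∈ Z}` by the other edges, so they are independent (`prob_inter_eq_mul_of_dependsOn`),
and for a `P`-stable `Z ⊆ {u ↮ a₂}`: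

  `Z = Z₀ ∩ Qinn`, `Z ∩ {b ∈ K} = Z₀ ∩ Kinn`, `Z ∩ {b ∈ L} = Z₀ ∩ Linn`

(`eq_off_inter`, `inter_bK_eq`, `inter_bL_eq`), whence the **pocket shares**

  `P(Z) = P(Z₀)·N`,  `N·P(Z, b ∈ K) = ρ_K·P(Z)`,  `N·P(Z, b ∈ L) = ρ_L·P(Z)`

with `N = P(Qinn)`, `ρ_K = P(Kinn)`, `ρ_L = P(Linn)` (`prob_eq_off_mul`, `prob_inter_bK`,
`prob_inter_bL`), and `N = 0 ⟹ P(Z) = 0` (`prob_eq_zero_of_N`).  For the coin class `P = {b}` these are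
`N = 1 − p₁p₂`, `ρ_K = p₁(1 − p₂)`, `ρ_L = (1 − p₁)p₂` (RootLeafUCoinShare).
-/

namespace Summit.Ventures.PercRepro2

namespace RootLeafU

namespace Pocket

variable {V : Type*} {E : Type*} [Fintype E] [DecidableEq E] {R : Type*} [CommRing R]

section Stable

variable {ends : E → Sym2 V} {P : Set V} {a₂ u : V} {off inn : Config E → Config E}

omit [Fintype E] [DecidableEq E] in
/-- Connections among vertices outside `P` are `P`-stable. -/
lemma stable_connEvent (hP : ∀ e y z, ends e = s(y, z) → y ∈ P → z ∈ P ∨ z = a₂ ∨ z = u)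
    (hoff : (∀ ω e, e ∈ touches ends P → off ω e = false) ∧ (∀ ω e, e ∉ touches ends P → off ω e = ω e))
    (hinn : (∀ ω e, e ∈ touches ends P → inn ω e = ω e) ∧ (∀ ω e, e ∉ touches ends P → inn ω e = false))
    {x y : V} (hx : x ∉ P) (hy : y ∉ P) :
    ∀ ω : Config E, ¬ Conn ends (inn ω) u a₂ → (ω ∈ connEvent ends x y ↔ off ω ∈ connEvent ends x y) :=
  fun _ hQ => conn_iff_off hP hoff hinn hQ hx hy

omit [Fintype E] [DecidableEq E] in
/-- Intersections of `P`-stable events are `P`-stable. -/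
lemma stable_inter {Z₁ Z₂ : Set (Config E)}
    (h1 : ∀ ω : Config E, ¬ Conn ends (inn ω) u a₂ → (ω ∈ Z₁ ↔ off ω ∈ Z₁))
    (h2 : ∀ ω : Config E, ¬ Conn ends (inn ω) u a₂ → (ω ∈ Z₂ ↔ off ω ∈ Z₂)) :
    ∀ ω : Config E, ¬ Conn ends (inn ω) u a₂ → (ω ∈ Z₁ ∩ Z₂ ↔ off ω ∈ Z₁ ∩ Z₂) :=
  fun ω hQ => and_congr (h1 ω hQ) (h2 ω hQ)

omit [Fintype E] [DecidableEq E] in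
/-- Complements of `P`-stable events are `P`-stable. -/
lemma stable_compl {Z : Set (Config E)}
    (h : ∀ ω : Config E, ¬ Conn ends (inn ω) u a₂ → (ω ∈ Z ↔ off ω ∈ Z)) :
    ∀ ω : Config E, ¬ Conn ends (inn ω) u a₂ → (ω ∈ Zᶜ ↔ off ω ∈ Zᶜ) :=
  fun ω hQ => not_congr (h ω hQ)

omit [Fintype E] [DecidableEq E] in
/-- `PD = {u ↮ a₂, c ∉ L ∪ K}` is `P`-stable (`c ∉ P`). -/
lemma stable_PD (hP : ∀ e y z, ends e = s(y, z) → y ∈ P → z ∈ P ∨ z = a₂ ∨ z = u)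
    (hoff : (∀ ω e, e ∈ touches ends P → off ω e = false) ∧ (∀ ω e, e ∉ touches ends P → off ω e = ω e))
    (hinn : (∀ ω e, e ∈ touches ends P → inn ω e = ω e) ∧ (∀ ω e, e ∉ touches ends P → inn ω e = false))
    (hu : u ∉ P) (ha : a₂ ∉ P) {c : V} (hc : c ∉ P) :
    ∀ ω : Config E, ¬ Conn ends (inn ω) u a₂ →
      (ω ∈ PDEvent ends u a₂ c ↔ off ω ∈ PDEvent ends u a₂ c) := by
  intro ω hQ
  simp only [PDEvent, Dtilde, UnionCluster.inU, Set.mem_inter_iff, Set.mem_compl_iff, Set.mem_union,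
    mem_connEvent]
  rw [conn_iff_off hP hoff hinn hQ hu ha, conn_iff_off hP hoff hinn hQ hc hu,
    conn_iff_off hP hoff hinn hQ hc ha]

omit [Fintype E] [DecidableEq E] in
/-- `T = {u ↮ a₂, c ∈ K}` is `P`-stable (`c ∉ P`). -/
lemma stable_T (hP : ∀ e y z, ends e = s(y, z) → y ∈ P → z ∈ P ∨ z = a₂ ∨ z = u)
    (hoff : (∀ ω e, e ∈ touches ends P → off ω e = false) ∧ (∀ ω e, e ∉ touches ends P → off ω e = ω e))
    (hinn : (∀ ω e, e ∈ touches ends P → inn ω e = ω e) ∧ (∀ ω e, e ∉ touches ends P → inn ω e = false))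
    (hu : u ∉ P) (ha : a₂ ∉ P) {c : V} (hc : c ∉ P) :
    ∀ ω : Config E, ¬ Conn ends (inn ω) u a₂ →
      (ω ∈ TEvent ends u a₂ c ↔ off ω ∈ TEvent ends u a₂ c) := by
  intro ω hQ
  simp only [TEvent, Set.mem_inter_iff, Set.mem_compl_iff, mem_connEvent]
  rw [conn_iff_off hP hoff hinn hQ ha hu, conn_iff_off hP hoff hinn hQ ha hc]

omit [Fintype E] [DecidableEq E] in
/-- `T′ = {u ↮ a₂, c ∈ L}` is `P`-stable (`c ∉ P`). -/
lemma stable_Tp (hP : ∀ e y z, ends e = s(y, z) → y ∈ P → z ∈ P ∨ z = a₂ ∨ z = u)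
    (hoff : (∀ ω e, e ∈ touches ends P → off ω e = false) ∧ (∀ ω e, e ∉ touches ends P → off ω e = ω e))
    (hinn : (∀ ω e, e ∈ touches ends P → inn ω e = ω e) ∧ (∀ ω e, e ∉ touches ends P → inn ω e = false))
    (hu : u ∉ P) (ha : a₂ ∉ P) {c : V} (hc : c ∉ P) :
    ∀ ω : Config E, ¬ Conn ends (inn ω) u a₂ →
      (ω ∈ TEvent ends a₂ u c ↔ off ω ∈ TEvent ends a₂ u c) := by
  intro ω hQ
  simp only [TEvent, Set.mem_inter_iff, Set.mem_compl_iff, mem_connEvent]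
  rw [conn_iff_off hP hoff hinn hQ hu ha, conn_iff_off hP hoff hinn hQ hu hc]

omit [Fintype E] [DecidableEq E] in
/-- On `PD ∩ X`, `u ↮ a₂`. -/
lemma PD_notConn {c : V} (X : Set (Config E)) : ∀ ω ∈ PDEvent ends u a₂ c ∩ X, ¬ Conn ends ω u a₂ :=
  fun _ hω => hω.1.1

omit [Fintype E] [DecidableEq E] in
/-- On `T ∩ X`, `u ↮ a₂`. -/
lemma T_notConn {c : V} (X : Set (Config E)) : ∀ ω ∈ TEvent ends u a₂ c ∩ X, ¬ Conn ends ω u a₂ :=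
  fun _ hω h => hω.1.1 (conn_symm h)

omit [Fintype E] [DecidableEq E] in
/-- On `T′ ∩ X`, `u ↮ a₂`. -/
lemma Tp_notConn {c : V} (X : Set (Config E)) : ∀ ω ∈ TEvent ends a₂ u c ∩ X, ¬ Conn ends ω u a₂ :=
  fun _ hω => hω.1.1

end Stable

section Independence

variable (p : E → R) {ends : E → Sym2 V} {P : Set V} {off inn : Config E → Config E}

omit [Fintype E] [DecidableEq E] in
/-- The off-copy `{ω | off ω ∈ Z}` is determined by the non-pocket edges. -/
lemma dependsOn_off
    (hoff : (∀ ω e, e ∈ touches ends P → off ω e = false) ∧ (∀ ω e, e ∉ touches ends P → off ω e = ω e))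
    (Z : Set (Config E)) : DependsOn (· ∈ {ω : Config E | off ω ∈ Z}) (touches ends P)ᶜ := by
  intro ω ω' h
  show (off ω ∈ Z) = (off ω' ∈ Z)
  rw [off_eq_of_eqOn hoff (fun e he => h e he)]

omit [Fintype E] [DecidableEq E] in
/-- The pocket copy `{ω | inn ω ∈ C}` is determined by the pocket edges. -/
lemma dependsOn_inn
    (hinn : (∀ ω e, e ∈ touches ends P → inn ω e = ω e) ∧ (∀ ω e, e ∉ touches ends P → inn ω e = false))
    (C : Set (Config E)) : DependsOn (· ∈ {ω : Config E | inn ω ∈ C}) (touches ends P) := by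
  intro ω ω' h
  show (inn ω ∈ C) = (inn ω' ∈ C)
  rw [inn_eq_of_eqOn hinn (fun e he => h e he)]

/-- The product rule for an off-copy against a pocket copy. -/
lemma prob_off_inter_inn
    (hoff : (∀ ω e, e ∈ touches ends P → off ω e = false) ∧ (∀ ω e, e ∉ touches ends P → off ω e = ω e))
    (hinn : (∀ ω e, e ∈ touches ends P → inn ω e = ω e) ∧ (∀ ω e, e ∉ touches ends P → inn ω e = false))
    (Z C : Set (Config E)) :
    prob p ({ω : Config E | off ω ∈ Z} ∩ {ω : Config E | inn ω ∈ C}) =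
      prob p {ω : Config E | off ω ∈ Z} * prob p {ω : Config E | inn ω ∈ C} :=
  prob_inter_eq_mul_of_dependsOn p disjoint_compl_left (dependsOn_off hoff Z) (dependsOn_inn hinn C)

end Independence

section Shares

variable (p : E → R) {ends : E → Sym2 V} {P : Set V} {a₂ u b : V} {off inn : Config E → Config E}

omit [Fintype E] [DecidableEq E] in
/-- A `P`-stable event inside `{u ↮ a₂}` is its off-copy intersected with `Qinn`. -/
lemma eq_off_inter
    (hinn : (∀ ω e, e ∈ touches ends P → inn ω e = ω e) ∧ (∀ ω e, e ∉ touches ends P → inn ω e = false))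
    {Z : Set (Config E)} (hZ : ∀ ω : Config E, ¬ Conn ends (inn ω) u a₂ → (ω ∈ Z ↔ off ω ∈ Z))
    (hZQ : ∀ ω ∈ Z, ¬ Conn ends ω u a₂) :
    Z = {ω : Config E | off ω ∈ Z} ∩ {ω : Config E | ¬ Conn ends (inn ω) u a₂} := by
  ext ω
  simp only [Set.mem_inter_iff, Set.mem_setOf_eq]
  constructor
  · intro hω
    have hQ := not_conn_inn_of_not_conn hinn (hZQ ω hω)
    exact ⟨(hZ ω hQ).1 hω, hQ⟩
  · rintro ⟨h0, hQ⟩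
    exact (hZ ω hQ).2 h0

omit [Fintype E] [DecidableEq E] in
/-- On a `P`-stable event inside `{u ↮ a₂}`, `b ∈ K` is the pocket event `Kinn`. -/
lemma inter_bK_eq (hP : ∀ e y z, ends e = s(y, z) → y ∈ P → z ∈ P ∨ z = a₂ ∨ z = u)
    (hoff : (∀ ω e, e ∈ touches ends P → off ω e = false) ∧ (∀ ω e, e ∉ touches ends P → off ω e = ω e))
    (hinn : (∀ ω e, e ∈ touches ends P → inn ω e = ω e) ∧ (∀ ω e, e ∉ touches ends P → inn ω e = false))
    (ha : a₂ ∉ P) (hb : b ∈ P) {Z : Set (Config E)}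
    (hZ : ∀ ω : Config E, ¬ Conn ends (inn ω) u a₂ → (ω ∈ Z ↔ off ω ∈ Z))
    (hZQ : ∀ ω ∈ Z, ¬ Conn ends ω u a₂) :
    Z ∩ connEvent ends a₂ b = {ω : Config E | off ω ∈ Z} ∩
      {ω : Config E | ¬ Conn ends (inn ω) u a₂ ∧ Conn ends (inn ω) a₂ b} := by
  ext ω
  simp only [Set.mem_inter_iff, Set.mem_setOf_eq, mem_connEvent]
  constructor
  · rintro ⟨hω, hc⟩
    have hQ := not_conn_inn_of_not_conn hinn (hZQ ω hω)
    exact ⟨(hZ ω hQ).1 hω, hQ, (conn_a₂_b_iff_inn hP hoff hinn ha (hZQ ω hω) hb).1 hc⟩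
  · rintro ⟨h0, hQ, hc⟩
    exact ⟨(hZ ω hQ).2 h0, conn_mono (inn_le hinn ω) hc⟩

omit [Fintype E] [DecidableEq E] in
/-- On a `P`-stable event inside `{u ↮ a₂}`, `b ∈ L` is the pocket event `Linn`. -/
lemma inter_bL_eq (hP : ∀ e y z, ends e = s(y, z) → y ∈ P → z ∈ P ∨ z = a₂ ∨ z = u)
    (hoff : (∀ ω e, e ∈ touches ends P → off ω e = false) ∧ (∀ ω e, e ∉ touches ends P → off ω e = ω e))
    (hinn : (∀ ω e, e ∈ touches ends P → inn ω e = ω e) ∧ (∀ ω e, e ∉ touches ends P → inn ω e = false))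
    (hu : u ∉ P) (hb : b ∈ P) {Z : Set (Config E)}
    (hZ : ∀ ω : Config E, ¬ Conn ends (inn ω) u a₂ → (ω ∈ Z ↔ off ω ∈ Z))
    (hZQ : ∀ ω ∈ Z, ¬ Conn ends ω u a₂) :
    Z ∩ connEvent ends u b = {ω : Config E | off ω ∈ Z} ∩
      {ω : Config E | ¬ Conn ends (inn ω) u a₂ ∧ Conn ends (inn ω) u b} := by
  ext ω
  simp only [Set.mem_inter_iff, Set.mem_setOf_eq, mem_connEvent]
  constructor
  · rintro ⟨hω, hc⟩
    have hQ := not_conn_inn_of_not_conn hinn (hZQ ω hω)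
    exact ⟨(hZ ω hQ).1 hω, hQ, (conn_u_b_iff_inn hP hoff hinn hu (hZQ ω hω) hb).1 hc⟩
  · rintro ⟨h0, hQ, hc⟩
    exact ⟨(hZ ω hQ).2 h0, conn_mono (inn_le hinn ω) hc⟩

/-- **The mass of a `P`-stable event inside `Q`**: `P(Z) = P(Z₀)·N`. -/
theorem prob_eq_off_mul
    (hoff : (∀ ω e, e ∈ touches ends P → off ω e = false) ∧ (∀ ω e, e ∉ touches ends P → off ω e = ω e))
    (hinn : (∀ ω e, e ∈ touches ends P → inn ω e = ω e) ∧ (∀ ω e, e ∉ touches ends P → inn ω e = false))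
    {Z : Set (Config E)} (hZ : ∀ ω : Config E, ¬ Conn ends (inn ω) u a₂ → (ω ∈ Z ↔ off ω ∈ Z))
    (hZQ : ∀ ω ∈ Z, ¬ Conn ends ω u a₂) :
    prob p Z = prob p {ω : Config E | off ω ∈ Z} * prob p {ω : Config E | ¬ Conn ends (inn ω) u a₂} := by
  conv_lhs => rw [eq_off_inter hinn hZ hZQ]
  exact prob_off_inter_inn p hoff hinn Z {ω : Config E | ¬ Conn ends ω u a₂}

/-- **The `b ∈ K` share** on a `P`-stable event inside `Q`: `N·P(Z, b ∈ K) = ρ_K·P(Z)`. -/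
theorem prob_inter_bK (hP : ∀ e y z, ends e = s(y, z) → y ∈ P → z ∈ P ∨ z = a₂ ∨ z = u)
    (hoff : (∀ ω e, e ∈ touches ends P → off ω e = false) ∧ (∀ ω e, e ∉ touches ends P → off ω e = ω e))
    (hinn : (∀ ω e, e ∈ touches ends P → inn ω e = ω e) ∧ (∀ ω e, e ∉ touches ends P → inn ω e = false))
    (ha : a₂ ∉ P) (hb : b ∈ P) {Z : Set (Config E)}
    (hZ : ∀ ω : Config E, ¬ Conn ends (inn ω) u a₂ → (ω ∈ Z ↔ off ω ∈ Z))
    (hZQ : ∀ ω ∈ Z, ¬ Conn ends ω u a₂) :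
    prob p {ω : Config E | ¬ Conn ends (inn ω) u a₂} * prob p (Z ∩ connEvent ends a₂ b) =
      prob p {ω : Config E | ¬ Conn ends (inn ω) u a₂ ∧ Conn ends (inn ω) a₂ b} * prob p Z := by
  have h := prob_off_inter_inn p hoff hinn Z {ω : Config E | ¬ Conn ends ω u a₂ ∧ Conn ends ω a₂ b}
  simp only [Set.mem_setOf_eq] at h
  rw [inter_bK_eq hP hoff hinn ha hb hZ hZQ, prob_eq_off_mul p hoff hinn hZ hZQ, h]
  ring

/-- **The `b ∈ L` share** on a `P`-stable event inside `Q`: `N·P(Z, b ∈ L) = ρ_L·P(Z)`. -/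
theorem prob_inter_bL (hP : ∀ e y z, ends e = s(y, z) → y ∈ P → z ∈ P ∨ z = a₂ ∨ z = u)
    (hoff : (∀ ω e, e ∈ touches ends P → off ω e = false) ∧ (∀ ω e, e ∉ touches ends P → off ω e = ω e))
    (hinn : (∀ ω e, e ∈ touches ends P → inn ω e = ω e) ∧ (∀ ω e, e ∉ touches ends P → inn ω e = false))
    (hu : u ∉ P) (hb : b ∈ P) {Z : Set (Config E)}
    (hZ : ∀ ω : Config E, ¬ Conn ends (inn ω) u a₂ → (ω ∈ Z ↔ off ω ∈ Z))
    (hZQ : ∀ ω ∈ Z, ¬ Conn ends ω u a₂) :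
    prob p {ω : Config E | ¬ Conn ends (inn ω) u a₂} * prob p (Z ∩ connEvent ends u b) =
      prob p {ω : Config E | ¬ Conn ends (inn ω) u a₂ ∧ Conn ends (inn ω) u b} * prob p Z := by
  have h := prob_off_inter_inn p hoff hinn Z {ω : Config E | ¬ Conn ends ω u a₂ ∧ Conn ends ω u b}
  simp only [Set.mem_setOf_eq] at h
  rw [inter_bL_eq hP hoff hinn hu hb hZ hZQ, prob_eq_off_mul p hoff hinn hZ hZQ, h]
  ring

/-- At `N = 0` every `P`-stable event inside `Q` is null. -/
theorem prob_eq_zero_of_N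
    (hoff : (∀ ω e, e ∈ touches ends P → off ω e = false) ∧ (∀ ω e, e ∉ touches ends P → off ω e = ω e))
    (hinn : (∀ ω e, e ∈ touches ends P → inn ω e = ω e) ∧ (∀ ω e, e ∉ touches ends P → inn ω e = false))
    {Z : Set (Config E)} (hZ : ∀ ω : Config E, ¬ Conn ends (inn ω) u a₂ → (ω ∈ Z ↔ off ω ∈ Z))
    (hZQ : ∀ ω ∈ Z, ¬ Conn ends ω u a₂)
    (hN : prob p {ω : Config E | ¬ Conn ends (inn ω) u a₂} = 0) : prob p Z = 0 := by
  rw [prob_eq_off_mul p hoff hinn hZ hZQ, hN, mul_zero]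

end Shares

end Pocket

end RootLeafU

end Summit.Ventures.PercRepro2
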